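import Literature.AlgebraicGeometry.Resolution.BlowupPrincipalCharts
import Literature.AlgebraicGeometry.Resolution.Blowups
import Literature.AlgebraicGeometry.Resolution.AffineBlowup
import HarnessLib

/-!
# Stalks of a blowing up over an affine open are stalks of the affine blowing up

Support file for crux stmt-ResolutionOfSingularities-15315
(`FrobeniusLadder.FInjectiveMacaulayfication`, line `Sketch`, seat c5): stub
`stub_blowupStalkOverAffine` of package A (stalks of a universal-property blow-up).

Let `π : X' → X₁` be a blowing up along the ideal sheaf `J` in the sense of the universal property
(`IsBlowup π J`, `Literature/AlgebraicGeometry/Resolution/Blowups.lean`) and `U ⊆ X₁` an affine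
open. By `IsBlowup.exists_chartImmersion` (uniqueness of blowing ups, Görtz–Wedhorn I,
Prop. 13.92) there is an open immersion `φ : Bl_{J(U)}(Spec Γ(X₁, U)) → X'` with image `π⁻¹(U)`,
where `Bl_{J(U)}(Spec Γ(X₁, U)) = affineBlowup (J.ideal U) = Proj Γ(X₁, U)[J(U) t]`
(`Literature/AlgebraicGeometry/Resolution/AffineBlowup.lean`). A point `x ∈ X'` over `U` is thus
`φ y` for some `y`, and the stalk map of the open immersion `φ` at `y` is an isomorphism
`𝒪_{X', x} ≅ 𝒪_{Bl, y}`.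

* `stub_blowupStalkOverAffine` — every stalk of `X'` at a point over `U` is ring-isomorphic to a
  stalk of `affineBlowup (J.ideal U)`.

References: U. Görtz, T. Wedhorn, *Algebraic Geometry I*, 2nd ed. (2020), Prop. 13.91, 13.92;
folklore (stalk maps of open immersions are isomorphisms).
-/

-- single-problem summit: the doubled namespace component is forced
set_option linter.dupNamespace false

namespace Summit.ResolutionOfSingularities.ResolutionOfSingularities.Theorems.FInjectiveMacaulayfication.BlowupStalkOverAffine

open AlgebraicGeometry CategoryTheory Literature.AlgebraicGeometry.Resolution

/-- A1 STALKS OF A BLOW-UP OVER AN AFFINE OPEN: if `π : X' → X₁` is a blow-up along the ideal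
sheaf `J` in the sense of the universal property (`IsBlowup`) and `U ⊆ X₁` is an affine open,
every stalk of `X'` at a point over `U` is isomorphic to a stalk of
`affineBlowup (J.ideal U) = Proj Γ(U)[J(U)t]` (the open immersion `affineBlowup (J.ideal U) → X'`
onto `π⁻¹ U` of `IsBlowup.exists_chartImmersion`; stalk maps of open immersions are
isomorphisms). [cite: GortzWedhorn2020, Prop. 13.91] -/
theorem stub_blowupStalkOverAffine : ∀ (X₁ X' : Scheme.{0}) (J : X₁.IdealSheafData) (π : X' ⟶ X₁),
    IsBlowup π J → ∀ (U : X₁.affineOpens) (x : X'), π.base x ∈ (U : X₁.Opens) →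
      ∃ y : ↥(affineBlowup (J.ideal U)),
        Nonempty (X'.presheaf.stalk x ≃+* (affineBlowup (J.ideal U)).presheaf.stalk y) := by
  intro X₁ X' J π hπ U x hx
  obtain ⟨φ, hφ, -, hrange⟩ := hπ.exists_chartImmersion U
  have hx' : x ∈ φ.opensRange := by
    rw [hrange]
    exact hx
  obtain ⟨y, rfl⟩ := hx'
  exact ⟨y, ⟨(asIso (φ.stalkMap y)).commRingCatIsoToRingEquiv⟩⟩

end Summit.ResolutionOfSingularities.ResolutionOfSingularities.Theorems.FInjectiveMacaulayfication.BlowupStalkOverAffine
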